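import Literature.NumberTheory.EllipticCurves.GreenbergVatsal2000.CharacterPAdicLFunctionInterpolationProofs
import HarnessLib

/-!
# Greenberg–Vatsal 2000, §3 pp. 41–42: the tree's definition of `L_{Σ₀}(C, T)`, `L_{Σ₀}(D, T)`
# (Kubota–Leopoldt values at `κ(γ)^{±(k−1)} − 1`) is EQUIVALENT to GV's characterization by the
# values at the character points `ζ − 1` (displays (26)/(27))

GV p. 41: "The `p`-adic `L`-function `L(C, χ, T) ∈ Λ` is characterized by the interpolation
property `L(C, χ, ζ − 1) = … = L(χψ⁻¹ρ, 0)` (26) for every nontrivial character `ρ` of `Γ` … As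
before, `ζ = ρ(γ)` … `L(C, χ, T)` is related to the Kubota-Leopoldt `p`-adic `L`-function
`L_p(χωψ⁻¹, s)` by `L_p(χωψ⁻¹, s) = L(C, χ, κ(γ)^{−s} − 1)` for all `s ∈ ℤ_p`."  The tree DEFINES
`L_{Σ₀}(C, T)` through the second sentence (`IsCharacterLFunctionC`: the values at `s = 1 − k`,
`k ≥ 1`); `CharacterPAdicLFunctionInterpolationProofs` proves that this element satisfies (26)
(in the form `L(θ', 0) = −B_{1,θ'}`) at every character of `Γ`. This file closes the circle: an
element of `Λ` satisfying (26) at every character of `Γ` (even Dirichlet characters modulo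
`p^{n+1}` of `p`-power order with values in `ℂ_p`, all `n`) IS the tree's `L_{Σ₀}(C, T)` — by the
uniqueness principle of Mazur–Tate–Teitelbaum §I.12–I.14 for the character points (the tree's
`MemIwasawaRat.eq_zero_of_forall_hasSum_zero`: an element of `Λ ⊗ ℚ_p` vanishing at `χ(γ) − 1`
for all primitive `χ` of all conductors `p^{k+3}` is zero). Hence

* `isCharacterLFunctionC_iff_hasSum_character` — `IsCharacterLFunctionC p φ Σ₀ g ↔` (26) holds
  for `g` at every character of `Γ`;
* `isCharacterLFunctionD_iff_hasSum_character` — likewise for `D` with (27) in the tree's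
  normalisation (see the READING NOTE of `CharacterPAdicLFunctionInterpolationProofs` on the unit
  `4` between GV's two printed sentences for `D`).

So the two printed characterizations of `L_{Σ₀}(C, T)` on GV p. 41 (display (26), and the
Kubota–Leopoldt relation) define the same element of `Λ`, in the kernel.

Everything is proved; there are no named facts and no new definitions.

References: [GreenbergVatsal2000] §3 pp. 41–42 (26)/(27); [MazurTateTeitelbaum1986] §I.12–I.14;
[LangCyclotomic1990] Ch. 4 §3 Thm. 3.2, Ch. 5 §2 Thm. 2.2.
-/

noncomputable section

open scoped Classical

open NumberField IsDedekindDomain Finset PowerSeries Literature.NumberTheory.EllipticCurves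

namespace Literature.NumberTheory.EllipticCurves.GreenbergVatsal2000

open CyclotomicZp

variable (p : ℕ) [Fact p.Prime]

/-- **Two elements of `Λ` with the same values at all character points `ρ(γ) − 1` are equal**
(`ρ` over the even Dirichlet characters modulo `p^{n+1}` of `p`-power order with values in `ℂ_p`,
all `n`) — the uniqueness principle of Mazur–Tate–Teitelbaum §I.12–I.14 (the tree's
`MemIwasawaRat.eq_zero_of_forall_hasSum_zero`, which needs only the primitive `ρ` of conductor
`p^{k+3}`) applied to the difference. [cite: MazurTateTeitelbaum1986, §I.12–I.14 (uniqueness of the interpolating element of Λ ⊗ ℚ_p)] -/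
theorem eq_of_forall_hasSum_character {g g' : IwasawaAlgebra p} {v : (n : ℕ) →
      DirichletCharacter ℂ_[p] (p ^ (n + 1)) → ℂ_[p]}
    (h : ∀ (n : ℕ) (ρ : DirichletCharacter ℂ_[p] (p ^ (n + 1))), ρ.Even →
      (∃ j : ℕ, orderOf ρ = p ^ j) →
      HasSum (fun k ↦ ((algebraMap ℚ_[p] ℂ_[p]).comp (algebraMap ℤ_[p] ℚ_[p]))
        (PowerSeries.coeff k g) * (ρ (cyclotomicGenerator p : ZMod (p ^ (n + 1))) - 1) ^ k) (v n ρ))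
    (h' : ∀ (n : ℕ) (ρ : DirichletCharacter ℂ_[p] (p ^ (n + 1))), ρ.Even →
      (∃ j : ℕ, orderOf ρ = p ^ j) →
      HasSum (fun k ↦ ((algebraMap ℚ_[p] ℂ_[p]).comp (algebraMap ℤ_[p] ℚ_[p]))
        (PowerSeries.coeff k g') * (ρ (cyclotomicGenerator p : ZMod (p ^ (n + 1))) - 1) ^ k) (v n ρ)) :
    g = g' := by
  rw [← sub_eq_zero]
  apply iwasawaToPowerSeries_injective p
  rw [map_zero]
  refine MemIwasawaRat.eq_zero_of_forall_hasSum_zero (memIwasawaRat_iwasawaToPowerSeries p _)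
    fun k χ _ heven hord ↦ ?_
  have hs := (h (k + 2) χ heven hord).sub (h' (k + 2) χ heven hord)
  rw [sub_self] at hs
  refine hs.congr_fun fun i ↦ ?_
  simp only [map_sub, PowerSeries.coeff_map, RingHom.comp_apply, sub_mul]

section C

variable {m : ℕ} [NeZero m] (φ : DirichletCharacter (ZMod p) m)
  (S₀ : Finset (HeightOneSpectrum (𝓞 ℚ)))

/-- **The tree's `L_{Σ₀}(C, T)` ⟺ GV's display (26)**: for `p` odd and `φ` primitive modulo `m`
with `p ∣ m`, an element `g ∈ Λ` satisfies `IsCharacterLFunctionC p φ Σ₀ g` (the Kubota–Leopoldt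
values at `κ(γ)^{k−1} − 1`, GV p. 41 "`L_p(χωψ⁻¹, s) = L(C, χ, κ(γ)^{−s} − 1)`") if and only if
`g(ρ(γ) − 1) = −B_{1,(φω⁻¹·1_{pΣ₀})ρ}` (`= L(ψ⁻¹ρ, 0)·∏_{l∈Σ₀}(1 − ψ⁻¹ρ(l))`, GV p. 41 (26) with
the p. 42 Euler factors) for every character `ρ` of `Γ` (even Dirichlet character modulo
`p^{n+1}` of `p`-power order, values in `ℂ_p`, every `n`). (⇒) is
`IsCharacterLFunctionC.hasSum_character`; (⇐) is the uniqueness principle at the character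
points (Mazur–Tate–Teitelbaum §I.12–I.14) against the element of `exists_isCharacterLFunctionC`.
[cite: GreenbergVatsal2000, §3 pp. 41–42 (display (26); L_p(χωψ⁻¹,s) = L(C,χ,κ(γ)^{−s} − 1); both characterize L(C,χ,T))]
[cite: MazurTateTeitelbaum1986, §I.12–I.14] -/
theorem isCharacterLFunctionC_iff_hasSum_character (hp : p ≠ 2) (hpm : p ∣ m)
    (hφ : φ.IsPrimitive) (g : IwasawaAlgebra p) :
    IsCharacterLFunctionC p φ S₀ g ↔
      ∀ (n : ℕ) (ρ : DirichletCharacter ℂ_[p] (p ^ (n + 1))), ρ.Even →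
        (∃ j : ℕ, orderOf ρ = p ^ j) →
        HasSum (fun k ↦ ((algebraMap ℚ_[p] ℂ_[p]).comp (algebraMap ℤ_[p] ℚ_[p]))
            (PowerSeries.coeff k g) * (ρ (cyclotomicGenerator p : ZMod (p ^ (n + 1))) - 1) ^ k)
          (-(∑ i ∈ Finset.range (depletedModulus p S₀ m * p ^ (n + 1)),
            ((algebraMap ℚ_[p] ℂ_[p]).comp (algebraMap ℤ_[p] ℚ_[p]))
                (depletedEvenCharacterTwist p φ S₀ 1 i) * ρ (i : ZMod (p ^ (n + 1))) *
              (((Polynomial.bernoulli 1).eval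
                ((i : ℚ) / (depletedModulus p S₀ m * p ^ (n + 1) : ℕ)) : ℚ) : ℂ_[p]))) := by
  refine ⟨fun hg n ρ heven hord ↦
    IsCharacterLFunctionC.hasSum_character p φ S₀ hp hpm hφ hg n ρ heven hord, fun h ↦ ?_⟩
  obtain ⟨g₀, hg₀, hchar⟩ := exists_isCharacterLFunctionC_character p φ S₀ hp hpm hφ
  rw [eq_of_forall_hasSum_character p h hchar]
  exact hg₀

end C

section D

variable {d : ℕ} [NeZero d] (ψ : DirichletCharacter (ZMod p) d) (S₀ : Finset (HeightOneSpectrum (𝓞 ℚ)))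

/-- **The tree's `L_{Σ₀}(D, T)` ⟺ display (27) (tree normalisation)**: for `p` odd, `p ∤ d`,
`Σ₀ ∌ p`, an element `g ∈ Λ` satisfies `IsCharacterLFunctionD p ψ Σ₀ g` (GV p. 42
"`L_p(ωχ⁻¹ψ⁻¹, s) = ½ L(D, χ, κ(γ)^s − 1)`" read at `s = 1 − k`) if and only if
`g(ρ(γ) − 1) = 2·(−B_{1,(ψ⁻¹·1_p)ρ⁻¹})·∏_{l∈Σ₀}(1 − ψ(l)ρ(l)l⁻¹)` for every character `ρ` of `Γ`
(the character `ψ⁻¹ρ⁻¹` and the Euler factors of (27); the leading `2` from the tree's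
normalisation, cf. the READING NOTE of `CharacterPAdicLFunctionInterpolationProofs`).
[cite: GreenbergVatsal2000, §3 p. 42 (display (27); L_p(ωχ⁻¹ψ⁻¹,s) = ½ L(D,χ,κ(γ)^s − 1))]
[cite: MazurTateTeitelbaum1986, §I.12–I.14] -/
theorem isCharacterLFunctionD_iff_hasSum_character (hp : p ≠ 2) (hpd : ¬ p ∣ d)
    (hS : ∀ v ∈ S₀, ((p : ℕ) : 𝓞 ℚ) ∉ v.asIdeal) (g : IwasawaAlgebra p) :
    IsCharacterLFunctionD p ψ S₀ g ↔
      ∀ (n : ℕ) (ρ : DirichletCharacter ℂ_[p] (p ^ (n + 1))), ρ.Even →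
        (∃ j : ℕ, orderOf ρ = p ^ j) →
        HasSum (fun k ↦ ((algebraMap ℚ_[p] ℂ_[p]).comp (algebraMap ℤ_[p] ℚ_[p]))
            (PowerSeries.coeff k g) * (ρ (cyclotomicGenerator p : ZMod (p ^ (n + 1))) - 1) ^ k)
          (2 * (-(∑ i ∈ Finset.range (d * p * p ^ (n + 1)),
            ((algebraMap ℚ_[p] ℂ_[p]).comp (algebraMap ℤ_[p] ℚ_[p])) (oddCharacterTwist p ψ 1 i) *
              ρ⁻¹ (i : ZMod (p ^ (n + 1))) *
              (((Polynomial.bernoulli 1).eval ((i : ℚ) / (d * p * p ^ (n + 1) : ℕ)) : ℚ) : ℂ_[p]))) *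
            ∏ v ∈ S₀, (1 - ((algebraMap ℚ_[p] ℂ_[p]).comp (algebraMap ℤ_[p] ℚ_[p]))
              (teichmullerLift p (ψ (Rat.HeightOneSpectrum.natGenerator v : ZMod d))) *
                (Rat.HeightOneSpectrum.natGenerator v : ℂ_[p])⁻¹ *
                ρ (Rat.HeightOneSpectrum.natGenerator v : ZMod (p ^ (n + 1))))) := by
  refine ⟨fun hg n ρ heven hord ↦
    IsCharacterLFunctionD.hasSum_character p ψ S₀ hp hpd hS hg n ρ heven hord, fun h ↦ ?_⟩
  have pp : p.Prime := Fact.out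
  obtain ⟨g₀, hg₀, hchar⟩ := exists_isCharacterLFunctionD_character p ψ S₀ hp hpd hS
  haveI : ∀ n : ℕ, NeZero (d * p * p ^ (n + 1)) := fun n ↦
    ⟨mul_ne_zero (mul_ne_zero (NeZero.ne d) pp.ne_zero) (pow_ne_zero _ pp.ne_zero)⟩
  have hchar' : ∀ (n : ℕ) (ρ : DirichletCharacter ℂ_[p] (p ^ (n + 1))), ρ.Even →
      (∃ j : ℕ, orderOf ρ = p ^ j) →
      HasSum (fun k ↦ ((algebraMap ℚ_[p] ℂ_[p]).comp (algebraMap ℤ_[p] ℚ_[p]))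
          (PowerSeries.coeff k g₀) * (ρ (cyclotomicGenerator p : ZMod (p ^ (n + 1))) - 1) ^ k)
        (2 * (-(∑ i ∈ Finset.range (d * p * p ^ (n + 1)),
          ((algebraMap ℚ_[p] ℂ_[p]).comp (algebraMap ℤ_[p] ℚ_[p])) (oddCharacterTwist p ψ 1 i) *
            ρ⁻¹ (i : ZMod (p ^ (n + 1))) *
            (((Polynomial.bernoulli 1).eval ((i : ℚ) / (d * p * p ^ (n + 1) : ℕ)) : ℚ) : ℂ_[p]))) *
          ∏ v ∈ S₀, (1 - ((algebraMap ℚ_[p] ℂ_[p]).comp (algebraMap ℤ_[p] ℚ_[p]))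
            (teichmullerLift p (ψ (Rat.HeightOneSpectrum.natGenerator v : ZMod d))) *
              (Rat.HeightOneSpectrum.natGenerator v : ℂ_[p])⁻¹ *
              ρ (Rat.HeightOneSpectrum.natGenerator v : ZMod (p ^ (n + 1))))) := by
    intro n ρ heven hord
    have h0 := hchar n ρ heven hord
    rwa [sum_castHom_mul_bernoulliDist_one_eq p (Dvd.intro_left _ rfl) ρ⁻¹] at h0
  rw [eq_of_forall_hasSum_character p h hchar']
  exact hg₀

end D

end Literature.NumberTheory.EllipticCurves.GreenbergVatsal2000

end
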